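import Literature.MathematicalPhysics.QuantumFieldTheory.Balaban1983to89.B9Eq311TracePairing
import Literature.MathematicalPhysics.QuantumFieldTheory.Balaban1983to89.B9Eq310HessianHermitian
import Literature.MathematicalPhysics.QuantumFieldTheory.Balaban1983to89.B9Eq326OperatorAssembly
import Literature.MathematicalPhysics.QuantumFieldTheory.Balaban1983to89.B9Eq3119InvariantExtension
import Literature.MathematicalPhysics.QuantumFieldTheory.Balaban1983to89.B11Eq90Transpose

/-!
# `Balaban1983to89.B9Eq3119DeltaPiCarrier` — T. Bałaban, *Propagators for lattice gauge theories in a background field*, Commun. Math. Phys. **99**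
# (1985) 389–434 [Balaban1985BackgroundPropagators] (3.119) p. 419 «⟨A, Δ_πA⟩ = ⟨A − DG′RD*A, Δ(A − DG′RD*A)⟩», as consumed by T. Bałaban, *The
# variational problem and background fields …*, Commun. Math. Phys. **102** (1985) 277–309 [Balaban1985Variational] (80), (87)–(89) pp. 290–291:
# THE GAUGE-INVARIANT EXTENSION `Δ_π(U) := π_Uᵗ Δ^η(U) π_U` OF THE HESSIAN AT THE pub-balaban NE9 CHAIN'S LETTERS, READ AS THE CURRENT-VALUED
# LETTER `Δπ : Space115 L η lev₀ lev₁ Dc →L[ℂ] NegSize L η lev₀ 3 𝔸` OF THE CREW's W₇ (`B11Eq80Current`), WITH ITS BILINEAR-SYMMETRY BINDER PROVED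
# and the vanishing on the gauge modes `D_U λ`, `λ ∈ N(Q′(U))`

statement-level skeleton of published theorems with citation tags; proofs where landed; nothing here is a claim
about the Yang–Mills mass gap

PDF held: `paper:balaban1985-cmp99-background-propagators` (journal page = PDF page + 388), pp. 392, 416, 419 (through `B9Eq3119InvariantExtension`'s
verbatim quotations, this lineage) ; `paper:balaban1985-cmp102-variational-background` (journal page = PDF page + 276), pp. 290–291 read by this seat
(2026-08-21) in the held text layer (p0014–p0015).

THE PRINT (verbatim).  [B11] p. 290 (80): *«They determine the functional V(A′) = −⟨HD₃(A′), J⟩ − ⟨A′, Δ_π HD(A′)⟩ + ½⟨HD(A′), Δ_π HD(A′)⟩ + V₀(A′ −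
HD(A′)). (80) It is analytic in A′ for A′ with values in the complexified algebra and satisfying (77).»*; p. 291: *«For the second term we have
⟨A′, Δ_π HD(A′)⟩ = ⟨A′, (Δ_U + DRD*)HD(A′)⟩ (87)»* (the gauge-invariant extension agrees with `Δ_U + DRD*` against a Landau-gauge `A′`), (88)–(89) its
functional derivatives.  [B9] p. 419 (3.119) as quoted in `B9Eq3119InvariantExtension`; p. 392: *«For U with values in the unitary group U(N) it is
a hermitian operator.»*

WHY THIS FILE (cell context).  The crew's W₇ (`…/Balaban1983to89/B11Eq80Current.lean`, NE9 leaf seat `…-leaf-05` gen 65, staged 844760a1baac8303) types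
`V` of (80) and `W := W₁ + W₂ + W₃ + curV0full` modulo two LETTERS, `J : NegSize … 3 𝔸` and `Δπ : Space115 L η lev₀ lev₁ Dc →L[ℂ] NegSize L η lev₀ 3 𝔸`
with the BILINEAR symmetry binder `hΔ : ∀ Y Z, pair27 τ (Δπ Y) (flat115 Z) = pair27 τ (Δπ Z) (flat115 Y)` (`pair27 τ K δ = η^d Σ_b τ(K(b)·δ(b))`).
This file SUPPLIES `Δπ` at the chain's carrier (leaf-05's WORD W-ne9leaf05-g65-1, «TAKE — build against THIS binder»): print's (3.119) with the
bilinear transpose `πᵗ` of `B9Eq311TracePairing` (NOT the Hilbert adjoint `π†` of `B9Eq3119InvariantExtension.invariantExtension`: with `π†` the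
bilinear symmetry would need the reality of `π`; with `πᵗ` it needs NOTHING of `π`), the Hessian `Δ^η(U) = B9Eq310HessianOperator.hessOp φ η U τ`
((3.10)), `π_U = 1 − D_U G′ R(U) D*_U` at E154/E159's letters with the Green's function `G′` of (3.24)–(3.25) a LETTER `Gp` (its construction
`greenK (Δ_U + Q′*aQ′) hpos′` rests on the displayed positivity of [B9] Thm 3.11; only (g5) `Q′λ = 0 → G′(Δ_U λ) = λ` is used, for the gauge modes),
and proves `hΔ` LITERALLY (`B11Eq90Transpose.pair27`, the crew's (A), p306593 ✓) and in the `pair27_eq_sum` form `η^d Σ_b τ(…)`.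

WHAT IS DEFINED AND PROVED (sorry-free; no `Prop` placeholder; no inequality of the papers).
* §3 (generic `WL2`) **`deltaPi φ π Δ := btrans φ π ∘ Δ ∘ π`**; `tpair_deltaPi` (`(A, Δ_π B) = (πA, Δ πB)` — (3.119) polarized), **`tpair_deltaPi_comm`**
  (`Δ_π` bilinear-symmetric ⇐ `Δ` is), `deltaPi_apply_eq_zero` (`πv = 0 → Δ_π v = 0`), `tpair_deltaPi_eq_zero_left`.
* §4 AT THE CHAIN'S HESSIAN: `apply_equiv_covCurlL2K` (the `L²` curl read on the fibre IS `B9Eq310DeltaPrime.curlAt`), `toAlg_starW`, **`covCurlL2K_starW`**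
  (the covariant curl is REAL at a unitary background: `D_U(f⋆) = (D_U f)⋆`, from `B9Eq310HessianHermitian.star_curlAt`), **`tpair_principalOpK_comm`**,
  **`tpair_curvOp_comm`** (`B9Eq310DeltaPrime.curvForm_symm`), **`tpair_hessOp_comm`**: `Δ^η(U)` IS SYMMETRIC FOR THE BILINEAR TRACE PAIRING (unitary
  `U`, `*`-trace, the cell's norming) — the bilinear companion of `hessOp_isSymmetric_of_trace`.
* §5 **`piOfU L m φ η U Gp := 1 − D_U ∘ Gp ∘ RofU ∘ D*_U`**, `piOfU_gaugeMode` (this lineage's `printProjectionLattice_gaugeMode`), **`deltaPiOfU`** (:=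
  `deltaPi φ (piOfU …) (hessOp φ η U τ)`), `tpair_deltaPiOfU`, **`tpair_deltaPiOfU_comm`**, **`deltaPiOfU_gaugeMode`** (`Δ_π(U)(D_U λ) = 0`, `λ ∈ N(Q′(U))`);
  §5b the letter CONSTRUCTED: `laplacePrimeA` ((3.24) `Δ′_a(U) = Δ_U + Q′(U)†a′Q′(U)`), `laplacePrimeA_apply_of_ker`, **`GpOfU … hpos'`** ((3.25) `G′ := greenK Δ′_a`,
  positivity DISPLAYED), `GpOfU_gaugeMode` ((g5) discharged, `printGreen_gaugeMode`), `deltaPiOfU_GpOfU_gaugeMode`.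
* §6 (generic `L²` operator `T`) **`currentCLM φ lev₁ Dc T : Space115 L η lev₀ lev₁ Dc →L[ℂ] NegSize L η lev₀ 3 𝔸`** (`flat115`, `readFun φ`,
  `NegSup.linearEquiv`; finite lattice ⇒ continuous), `equiv_currentCLM`, `sum_trace_currentCLM`, **`pairSum_currentCLM_comm`** (the `η^d Σ_b τ(…)`
  symmetry ⇐ `T` bilinear-symmetric + `τ` tracial).
* §7 THE LETTER: **`deltaPiCLM L m φ τ U Gp lev₁ Dc`**, **`deltaPiCLM_pairSum_comm`** (W₇'s `hΔ` in `pair27_eq_sum` form) and **`deltaPiCLM_pair27_comm`**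
  (W₇'s `hΔ` VERBATIM: `∀ Y Z, pair27 τ (Δπ Y) (flat115 Z) = pair27 τ (Δπ Z) (flat115 Y)`, `τ` a CLM as there) under `hτ₂`, `hφ`, `hU`; **`deltaPiCLM_gaugeMode`**.
MODEL / DECLARED READINGS.  (M1) as `B9Eq310HessianOperator`/`B9Eq326OperatorAssembly`: fine torus `TSite d (L·m)`, fibre `W` read in the `*`-algebra `𝔸`
along `φ`, weight `c₀`, scalar `η⁻¹`; (115)-carriers of `B11Eq115Space` with `Dc`, `lev₀`, `lev₁` GENERIC (the owner instantiates `Dc := nabla115 η U`); the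
real `Lr` of the weights is independent of the block size `L : ℕ`.  (M2) `G′` is a LETTER `Gp` with (g5) displayed where used, OR the constructed `GpOfU … hpos'`
of §5b under the DISPLAYED positivity `hpos'` of `Δ′_a(U)` ([B9] Thm 3.11) — then (g5) is discharged.  (M3) NOT HERE: the operator norm `‖Δπ‖` (W₇'s NEEDS-CONSTANT letter; [B9] (3.132)), locality (3.117), any estimate.
HONEST SCOPE.  Definitions + [folklore] `*`-algebra bookkeeping over E155/E157's constructed forms; (L3) W NOT closed by this file; NOT summit progress
(cell pub-balaban: NE9 NOT PRINTED / NOT PROVED; spine PROVED 0/9).  Filed by the pub-balaban NE9 leaf seat `b2b-balaban-t4-ne9-formalise-leaf-01`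
(gen 72); NEW file; nothing modified.  Net new unproved facts: 0.
-/

noncomputable section

open scoped InnerProductSpace ComplexConjugate BigOperators

namespace Literature.MathematicalPhysics.QuantumFieldTheory.Balaban1983to89.B9Eq3119DeltaPiCarrier

open B9Eq311L2Pairing (WL2)
open B9Eq311TracePairing (starW equiv_starW apply_equiv_starW starW_starW tpair tpair_def tpair_comm tpair_add_right tpair_eq_inner_starW btrans
  tpair_btrans)

/-! ## §3 `Δ_π := πᵗ Δ π` — the gauge-invariant extension (3.119) as the operator of the BILINEAR form `(πA, Δ πB)` -/

section DeltaPi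

variable {𝔸 : Type*} [Ring 𝔸] [StarRing 𝔸] [Algebra ℂ 𝔸] [StarModule ℂ 𝔸]
  {W : Type*} [NormedAddCommGroup W] [InnerProductSpace ℂ W] [FiniteDimensional ℂ W] (φ : W ≃ₗ[ℂ] 𝔸) (τ : 𝔸 →ₗ[ℂ] ℂ)
  {ι : Type*} [Fintype ι] {w : ι → ℝ} [Fact (∀ i, 0 < w i)] (π Δ : WL2 ℂ w W →ₗ[ℂ] WL2 ℂ w W)

/-- **(3.119) `Δ_π := πᵗ Δ π`** — the operator whose BILINEAR form is print's «⟨A, Δ_πA⟩ = ⟨A − DG′RD*A, Δ(A − DG′RD*A)⟩» polarized: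
`(A, Δ_π B) = (πA, Δ πB)`. [cite: Balaban1985BackgroundPropagators, (3.119) p.419] -/
def deltaPi : WL2 ℂ w W →ₗ[ℂ] WL2 ℂ w W := btrans φ π ∘ₗ Δ ∘ₗ π

/-- **`(A, Δ_π B) = (πA, Δ(πB))`.** [cite: Balaban1985BackgroundPropagators, (3.119) p.419] -/
theorem tpair_deltaPi (hφ : ∀ X Y : 𝔸, ⟪φ.symm X, φ.symm Y⟫_ℂ = τ (star X * Y)) (A B : WL2 ℂ w W) :
    tpair φ τ A (deltaPi φ π Δ B) = tpair φ τ (π A) (Δ (π B)) := by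
  rw [deltaPi, LinearMap.comp_apply, LinearMap.comp_apply, tpair_btrans φ τ hφ]

/-- **`Δ_π` IS SYMMETRIC for the bilinear pairing whenever `Δ` is** (no reality or Hermitian hypothesis on `π`).
[cite: Balaban1985BackgroundPropagators, (3.119) p.419] -/
theorem tpair_deltaPi_comm (hφ : ∀ X Y : 𝔸, ⟪φ.symm X, φ.symm Y⟫_ℂ = τ (star X * Y))
    (hΔ : ∀ x y : WL2 ℂ w W, tpair φ τ x (Δ y) = tpair φ τ y (Δ x)) (A B : WL2 ℂ w W) :
    tpair φ τ A (deltaPi φ π Δ B) = tpair φ τ B (deltaPi φ π Δ A) := by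
  rw [tpair_deltaPi φ τ π Δ hφ, tpair_deltaPi φ τ π Δ hφ, hΔ]

/-- **`Δ_π` KILLS WHATEVER `π` KILLS** (the gauge modes `Dλ`, `λ ∈ N(Q′)`, once `π(Dλ) = 0`). [cite: Balaban1985BackgroundPropagators, (3.119) p.419] -/
theorem deltaPi_apply_eq_zero {v : WL2 ℂ w W} (hπ : π v = 0) : deltaPi φ π Δ v = 0 := by
  rw [deltaPi, LinearMap.comp_apply, LinearMap.comp_apply, hπ, map_zero, map_zero]

/-- … and is INVISIBLE to them on the left: `(v, Δ_π B) = 0` when `πv = 0`. [cite: Balaban1985BackgroundPropagators, (3.119) p.419] -/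
theorem tpair_deltaPi_eq_zero_left (hφ : ∀ X Y : 𝔸, ⟪φ.symm X, φ.symm Y⟫_ℂ = τ (star X * Y)) {v : WL2 ℂ w W} (hπ : π v = 0)
    (B : WL2 ℂ w W) : tpair φ τ v (deltaPi φ π Δ B) = 0 := by
  rw [tpair_deltaPi φ τ π Δ hφ, hπ, tpair_def]
  simp only [WL2.equiv_zero, Pi.zero_apply, map_zero, zero_mul, mul_zero, Finset.sum_const_zero]

end DeltaPi

/-! ## §4 At the chain's letters: the Hessian `Δ^η(U)` of (3.10) is symmetric for the BILINEAR pairing (unitary background, `*`-trace) -/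

section Chain

open B9SectCLatticeCarrier (Bond)
open B11Eq103H1Complex (BondL2K)
open B9Eq34CovCurlVector (covCurl covCurl_apply_coord)
open B9Eq33CovDerivVector (adTransport adTransport_apply)
open B9Eq310DeltaPrime (curlAt curlAt_apply curvForm curvForm_symm)
open B9Eq310HessianOperator (toAlg adTransportW adTransportW_apply PlaqL2K covCurlL2K equiv_covCurlL2K adjoint_covCurlL2K principalOpK
  principalOpK_eq_comp curvOp inner_curvOp hessOp hessOp_apply)
open B9Eq310HessianHermitian (star_curlAt adTransportW_adjoint)

variable {d : ℕ} {Pd : Fin d → ℕ} {𝔸 : Type*} [Ring 𝔸] [StarRing 𝔸] [Algebra ℂ 𝔸] [StarModule ℂ 𝔸]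
  {W : Type*} [NormedAddCommGroup W] [InnerProductSpace ℂ W] [FiniteDimensional ℂ W] (φ : W ≃ₗ[ℂ] 𝔸) {c₀ : ℝ} [Fact (0 < c₀)]
  (τ : 𝔸 →ₗ[ℂ] ℂ) (hτ₁ : ∀ X : 𝔸, τ (star X) = conj (τ X)) (hτ₂ : ∀ X Y : 𝔸, τ (X * Y) = τ (Y * X))
  (hφ : ∀ X Y : 𝔸, ⟪φ.symm X, φ.symm Y⟫_ℂ = τ (star X * Y)) (η : ℝ) {U : Bond d Pd → 𝔸ˣ} (hU : ∀ b, star (U b : 𝔸) = ((U b)⁻¹ : 𝔸ˣ))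

omit [StarRing 𝔸] [StarModule ℂ 𝔸] [FiniteDimensional ℂ W] in
/-- The curl (3.4) with the transporters READ ON THE FIBRE is the curl of the algebra-valued function: `φ((D_U f)(p)) = (D_U (φ∘f))(p)`.
[cite: Balaban1985BackgroundPropagators, (3.4) p.391] -/
theorem apply_equiv_covCurlL2K (c : ℂ) (U : Bond d Pd → 𝔸ˣ) (f : BondL2K ℂ d Pd c₀ W) (p : B9SectCLatticeCarrier.Plaq d Pd) :
    φ (WL2.equiv ℂ _ W (covCurlL2K ℂ c₀ c (adTransportW φ U) f) p) = curlAt c U p (toAlg φ f) := by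
  obtain ⟨x, q⟩ := p
  rw [equiv_covCurlL2K, curlAt_apply, covCurl_apply_coord, covCurl_apply_coord]
  simp only [map_smul, map_sub, adTransportW_apply, adTransport_apply, LinearEquiv.apply_symm_apply]
  rfl

omit [StarModule ℂ 𝔸] [FiniteDimensional ℂ W] [Fact (0 < c₀)] in
/-- `φ((f⋆)(b)) = (φ f(b))*` on the algebra-valued reading `toAlg`. [cite: Balaban1985BackgroundPropagators, (3.11) p.392] -/
theorem toAlg_starW (f : BondL2K ℂ d Pd c₀ W) : toAlg φ (starW φ f) = star (toAlg φ f) := by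
  funext b
  exact apply_equiv_starW φ f b

include hU in
omit [FiniteDimensional ℂ W] in
/-- **THE COVARIANT CURL IS REAL at a unitary background and a real scalar: `D_U(f⋆) = (D_U f)⋆`** (`B9Eq310HessianHermitian.star_curlAt` on the
`L²` spaces). [cite: Balaban1985BackgroundPropagators, (3.4) p.391] -/
theorem covCurlL2K_starW (f : BondL2K ℂ d Pd c₀ W) :
    covCurlL2K ℂ c₀ ((η : ℂ))⁻¹ (adTransportW φ U) (starW φ f) = starW φ (covCurlL2K ℂ c₀ ((η : ℂ))⁻¹ (adTransportW φ U) f) := by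
  apply (WL2.equiv ℂ (fun _ : B9SectCLatticeCarrier.Plaq d Pd => c₀) W).injective
  funext p
  apply φ.injective
  rw [apply_equiv_covCurlL2K, toAlg_starW, ← star_curlAt hU, apply_equiv_starW, apply_equiv_covCurlL2K]

include hτ₂ hφ hU in
/-- **The principal part `D*D` is symmetric for the BILINEAR pairing**: `(x, D*Dy) = (D x, D y)_plaq = (y, D*Dx)` — adjointness of (3.9)/(3.4)
(`adjoint_covCurlL2K`, transporters mutually adjoint by `adTransportW_adjoint`), reality of the curl, traciality.
[cite: Balaban1985BackgroundPropagators, (3.10) p.392] -/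
theorem tpair_principalOpK_comm (x y : BondL2K ℂ d Pd c₀ W) :
    tpair φ τ x (principalOpK φ η U y) = tpair φ τ y (principalOpK φ η U x) := by
  have hc : conj (((η : ℂ))⁻¹) = ((η : ℂ))⁻¹ := by rw [map_inv₀, Complex.conj_ofReal]
  have hRS := adTransportW_adjoint φ τ hτ₂ hU hφ
  have key : ∀ x y : BondL2K ℂ d Pd c₀ W, tpair φ τ x (principalOpK φ η U y) =
      tpair φ τ (covCurlL2K ℂ c₀ ((η : ℂ))⁻¹ (adTransportW φ U) x) (covCurlL2K ℂ c₀ ((η : ℂ))⁻¹ (adTransportW φ U) y) := fun x y => by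
    rw [tpair_eq_inner_starW φ τ hφ, tpair_eq_inner_starW φ τ hφ, principalOpK_eq_comp, LinearMap.comp_apply,
      ← adjoint_covCurlL2K _ hc _ _ hRS, LinearMap.adjoint_inner_right, covCurlL2K_starW φ η hU]
  rw [key, key, tpair_comm φ τ hτ₂]

include hφ in
/-- **The curvature part `Δ′` is symmetric for the BILINEAR pairing**: `(x, Δ′y) = curvForm(Φx, Φy)` (the `star` of `inner_curvOp` cancels against
`x⋆`), symmetric by `B9Eq310DeltaPrime.curvForm_symm`. [cite: Balaban1985BackgroundPropagators, (3.10) p.392] -/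
theorem tpair_curvOp_comm (x y : BondL2K ℂ d Pd c₀ W) : tpair φ τ x (curvOp φ τ η U y) = tpair φ τ y (curvOp φ τ η U x) := by
  rw [tpair_eq_inner_starW φ τ hφ, tpair_eq_inner_starW φ τ hφ, inner_curvOp, inner_curvOp, toAlg_starW, toAlg_starW, star_star, star_star,
    curvForm_symm]

include hτ₂ hφ hU in
/-- **THE HESSIAN `Δ^η(U) = D*D + Δ′` IS SYMMETRIC FOR THE BILINEAR TRACE PAIRING** at a unitary background with a `*`-trace and the cell's norming —
the complex-bilinear (analytic) counterpart of print's «hermitian operator» (`hessOp_isSymmetric_of_trace` is the sesquilinear one).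
[cite: Balaban1985BackgroundPropagators, (3.10) p.392] -/
theorem tpair_hessOp_comm (x y : BondL2K ℂ d Pd c₀ W) : tpair φ τ x (hessOp φ η U τ y) = tpair φ τ y (hessOp φ η U τ x) := by
  rw [hessOp_apply, hessOp_apply, tpair_add_right, tpair_add_right, tpair_principalOpK_comm φ τ hτ₂ hφ η hU x y,
    tpair_curvOp_comm φ τ hφ η x y]

end Chain

/-! ## §5 Print's `π_U = 1 − D_U G′ R(U) D*_U` at the chain's letters and `Δ_π(U) := π_Uᵗ Δ^η(U) π_U` -/

section PiOfU

open B9SectCLatticeCarrier (Bond)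
open B9Eq319QprimeTorus (fineP)
open B11Eq103H1Complex (SiteL2K BondL2K covDerivL2K covDivL2K covLaplaceSiteK)
open B9Eq310HessianOperator (adTransportW hessOp)
open B9Eq326OperatorAssembly (QprimeW RofU)
open B9Eq3119InvariantExtension (printProjectionLattice_gaugeMode printGreen_gaugeMode)
open B11Eq103H1Complex (greenK)

variable {d : ℕ} (L : ℕ) [NeZero L] (m : Fin d → ℕ) {𝔸 : Type*} [Ring 𝔸] [StarRing 𝔸] [Algebra ℂ 𝔸] [StarModule ℂ 𝔸]
  {W : Type*} [NormedAddCommGroup W] [InnerProductSpace ℂ W] [FiniteDimensional ℂ W] (φ : W ≃ₗ[ℂ] 𝔸) {c₀ : ℝ} [Fact (0 < c₀)]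
  (τ : 𝔸 →ₗ[ℂ] ℂ) (η : ℝ) (U : Bond d (fineP L m) → 𝔸ˣ)
  (Gp : SiteL2K ℂ d (fineP L m) c₀ W →ₗ[ℂ] SiteL2K ℂ d (fineP L m) c₀ W)

/-- **Print's `π_U := 1 − D_U G′ R(U) D*_U`** ([B9] p. 419: «the expression A − DG′RD*A») at the chain's letters — `D_U`∕`D*_U` = (3.3)∕(3.8) at the
transporters `R(U(b))`∕`R(U(b)⁻¹)` and the scalar `η⁻¹`, `R(U)` = `B9Eq326OperatorAssembly.RofU` ((3.21) at the concrete `Q′(U)`), and the Green's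
function `G′ = (Δ′_a)⁻¹` of (3.24)–(3.25) a LETTER `Gp` (its construction `greenK (Δ_U + Q′*aQ′) hpos′` needs the displayed positivity of
[B9] Thm 3.11; the only property used below is (g5) `Q′λ = 0 → G′(Δ_U λ) = λ`). [cite: Balaban1985BackgroundPropagators, (3.119) p.419, (3.21) p.394, (3.24)–(3.25) p.394] -/
def piOfU : BondL2K ℂ d (fineP L m) c₀ W →ₗ[ℂ] BondL2K ℂ d (fineP L m) c₀ W :=
  LinearMap.id - covDerivL2K ℂ c₀ ((η : ℂ))⁻¹ (adTransportW φ U) ∘ₗ Gp ∘ₗ RofU L m φ η U ∘ₗ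
    covDivL2K ℂ c₀ ((η : ℂ))⁻¹ (adTransportW φ fun b => (U b)⁻¹)

omit [StarRing 𝔸] [StarModule ℂ 𝔸] in
/-- **`π_U` KILLS THE GAUGE MODES `D_U λ`, `λ ∈ N(Q′(U))`** (p303874 `printProjectionLattice_gaugeMode` at the chain's `R(U)`), given (g5) for the letter
`G′`. [cite: Balaban1985BackgroundPropagators, (3.119) p.419] -/
theorem piOfU_gaugeMode (hGp : ∀ l : SiteL2K ℂ d (fineP L m) c₀ W, QprimeW L m φ U l = 0 →
      Gp (covLaplaceSiteK ((η : ℂ))⁻¹ (adTransportW φ U) (adTransportW φ fun b => (U b)⁻¹) l) = l)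
    {l : SiteL2K ℂ d (fineP L m) c₀ W} (hl : QprimeW L m φ U l = 0) :
    piOfU L m φ η U Gp (covDerivL2K ℂ c₀ ((η : ℂ))⁻¹ (adTransportW φ U) l) = 0 :=
  printProjectionLattice_gaugeMode Gp hGp hl

/-- **`Δ_π(U) := π_Uᵗ Δ^η(U) π_U`** — (3.119) at the chain's Hessian `B9Eq310HessianOperator.hessOp φ η U τ` ((3.10)), with the BILINEAR transpose.
[cite: Balaban1985BackgroundPropagators, (3.119) p.419, (3.10) p.392] -/
def deltaPiOfU : BondL2K ℂ d (fineP L m) c₀ W →ₗ[ℂ] BondL2K ℂ d (fineP L m) c₀ W := deltaPi φ (piOfU L m φ η U Gp) (hessOp φ η U τ)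

/-- **`(A, Δ_π(U) B) = (π_U A, Δ^η(U) π_U B)`** — print's definition (3.119), polarized. [cite: Balaban1985BackgroundPropagators, (3.119) p.419] -/
theorem tpair_deltaPiOfU (hφ : ∀ X Y : 𝔸, ⟪φ.symm X, φ.symm Y⟫_ℂ = τ (star X * Y)) (A B : BondL2K ℂ d (fineP L m) c₀ W) :
    tpair φ τ A (deltaPiOfU L m φ τ η U Gp B) = tpair φ τ (piOfU L m φ η U Gp A) (hessOp φ η U τ (piOfU L m φ η U Gp B)) :=
  tpair_deltaPi φ τ _ _ hφ A B

/-- **`Δ_π(U)` IS SYMMETRIC FOR THE BILINEAR TRACE PAIRING** (unitary background, `*`-trace, the cell's norming) — whatever the letter `G′`.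
[cite: Balaban1985BackgroundPropagators, (3.119) p.419] -/
theorem tpair_deltaPiOfU_comm (hτ₂ : ∀ X Y : 𝔸, τ (X * Y) = τ (Y * X)) (hφ : ∀ X Y : 𝔸, ⟪φ.symm X, φ.symm Y⟫_ℂ = τ (star X * Y))
    (hU : ∀ b, star (U b : 𝔸) = ((U b)⁻¹ : 𝔸ˣ)) (A B : BondL2K ℂ d (fineP L m) c₀ W) :
    tpair φ τ A (deltaPiOfU L m φ τ η U Gp B) = tpair φ τ B (deltaPiOfU L m φ τ η U Gp A) :=
  tpair_deltaPi_comm φ τ _ _ hφ (tpair_hessOp_comm φ τ hτ₂ hφ η hU) A B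

/-- **`Δ_π(U)` KILLS THE GAUGE MODES**: `Δ_π(U)(D_U λ) = 0` for `λ ∈ N(Q′(U))` — the reason (88)∕(89) of [Balaban1985Variational] see only physical modes.
[cite: Balaban1985BackgroundPropagators, (3.119) p.419; Balaban1985Variational, (88)–(89) p.291] -/
theorem deltaPiOfU_gaugeMode (hGp : ∀ l : SiteL2K ℂ d (fineP L m) c₀ W, QprimeW L m φ U l = 0 →
      Gp (covLaplaceSiteK ((η : ℂ))⁻¹ (adTransportW φ U) (adTransportW φ fun b => (U b)⁻¹) l) = l)
    {l : SiteL2K ℂ d (fineP L m) c₀ W} (hl : QprimeW L m φ U l = 0) :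
    deltaPiOfU L m φ τ η U Gp (covDerivL2K ℂ c₀ ((η : ℂ))⁻¹ (adTransportW φ U) l) = 0 :=
  deltaPi_apply_eq_zero φ _ _ (piOfU_gaugeMode L m φ η U Gp hGp hl)

/-! ### §5b The Green's-function letter CONSTRUCTED: `G′ := (Δ′_a(U))⁻¹`, `Δ′_a(U) = Δ_U + Q′(U)* a′ Q′(U)` ((3.24)–(3.25)), modulo its positivity -/

variable {c₁ : ℝ} [Fact (0 < c₁)] (a' : ℝ)

/-- **(3.24) `Δ′_a(U) := Δ_U + Q′(U)* a′ Q′(U)`** on the `L²` gauge parameters of the fine torus: `Δ_U = D*_U D_U` (`covLaplaceSiteK`) plus the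
averaging penalty, `Q′(U)` (`B9Eq326OperatorAssembly.QprimeW`) read into the weighted `L²` space of the unit lattice (weight `c₁`) and `Q′* := Q′†`.
[cite: Balaban1985BackgroundPropagators, (3.24) p.394] -/
def laplacePrimeA : SiteL2K ℂ d (fineP L m) c₀ W →ₗ[ℂ] SiteL2K ℂ d (fineP L m) c₀ W :=
  covLaplaceSiteK ((η : ℂ))⁻¹ (adTransportW φ U) (adTransportW φ fun b => (U b)⁻¹) +
    (a' : ℂ) • (LinearMap.adjoint ((WL2.linearEquiv ℂ ℂ (fun _ : B4Sect5Torus.TSite d m => c₁)).symm.toLinearMap ∘ₗ QprimeW L m φ U) ∘ₗ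
      ((WL2.linearEquiv ℂ ℂ (fun _ : B4Sect5Torus.TSite d m => c₁)).symm.toLinearMap ∘ₗ QprimeW L m φ U))

omit [StarRing 𝔸] [StarModule ℂ 𝔸] in
/-- On `N(Q′(U))` the penalty vanishes: `Δ′_a λ = Δ_U λ` for `Q′(U)λ = 0` (the agreement (g5) needs). [cite: Balaban1985BackgroundPropagators, (3.24)–(3.25) p.394] -/
theorem laplacePrimeA_apply_of_ker {l : SiteL2K ℂ d (fineP L m) c₀ W} (hl : QprimeW L m φ U l = 0) :
    laplacePrimeA L m φ η U a' (c₁ := c₁) l = covLaplaceSiteK ((η : ℂ))⁻¹ (adTransportW φ U) (adTransportW φ fun b => (U b)⁻¹) l := by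
  simp only [laplacePrimeA, LinearMap.add_apply, LinearMap.smul_apply, LinearMap.comp_apply, hl, map_zero, smul_zero, add_zero]

variable (hpos' : ∀ x : SiteL2K ℂ d (fineP L m) c₀ W, x ≠ 0 → 0 < RCLike.re ⟪x, laplacePrimeA L m φ η U a' (c₁ := c₁) x⟫_ℂ)

/-- **(3.25) `G′ := (Δ′_a(U))⁻¹` CONSTRUCTED** (`B11Eq103H1Complex.greenK`) from the DISPLAYED positivity of `Δ′_a(U)` ([B9] Thm 3.11: «Δ′_a, G′ …
positive definite») — an admissible value of the letter `Gp`. [cite: Balaban1985BackgroundPropagators, (3.25) p.394, Thm 3.11 p.416] -/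
def GpOfU : SiteL2K ℂ d (fineP L m) c₀ W →ₗ[ℂ] SiteL2K ℂ d (fineP L m) c₀ W := greenK (laplacePrimeA L m φ η U a' (c₁ := c₁)) hpos'

omit [StarRing 𝔸] [StarModule ℂ 𝔸] in
/-- **(g5) DISCHARGED for the constructed `G′`**: `Q′(U)λ = 0 → G′(Δ_U λ) = λ` (this lineage's `printGreen_gaugeMode`). [cite: Balaban1985BackgroundPropagators, (3.24)–(3.25) p.394] -/
theorem GpOfU_gaugeMode (l : SiteL2K ℂ d (fineP L m) c₀ W) (hl : QprimeW L m φ U l = 0) :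
    GpOfU L m φ η U a' hpos' (covLaplaceSiteK ((η : ℂ))⁻¹ (adTransportW φ U) (adTransportW φ fun b => (U b)⁻¹) l) = l :=
  printGreen_gaugeMode (Q' := QprimeW L m φ U) _ hpos' (fun _ hl => laplacePrimeA_apply_of_ker L m φ η U a' hl) hl

/-- Hence **`Δ_π(U)` at `Gp := G′ = (Δ′_a(U))⁻¹` kills the gauge modes with NO letter but the positivity of `Δ′_a(U)`**.
[cite: Balaban1985BackgroundPropagators, (3.119) p.419, (3.25) p.394] -/
theorem deltaPiOfU_GpOfU_gaugeMode {l : SiteL2K ℂ d (fineP L m) c₀ W} (hl : QprimeW L m φ U l = 0) :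
    deltaPiOfU L m φ τ η U (GpOfU L m φ η U a' hpos') (covDerivL2K ℂ c₀ ((η : ℂ))⁻¹ (adTransportW φ U) l) = 0 :=
  deltaPiOfU_gaugeMode L m φ τ η U _ (fun l hl => GpOfU_gaugeMode L m φ η U a' hpos' l hl) hl

end PiOfU

/-! ## §6 THE CARRIER READING: an `L²` operator as a current-valued map `Space115 → NegSize … 3`, and the (27)-pairing form of the symmetry -/

section Carrier

open B9SectCLatticeCarrier (Bond)
open B11Eq103H1Complex (BondL2K funEquiv funEquiv_symm_apply readFun readFun_apply)
open B11Eq115Space (NegSup NegSize Space115 levWeight JetSup)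
open B11Eq90V0primeCurrent (flat115)

variable {d : ℕ} {Pd : Fin d → ℕ} {𝔸 : Type*} [NormedRing 𝔸] [NormedAlgebra ℂ 𝔸] [FiniteDimensional ℂ 𝔸]
  {W : Type*} [NormedAddCommGroup W] [InnerProductSpace ℂ W] [FiniteDimensional ℂ W] (φ : W ≃ₗ[ℂ] 𝔸) {c₀ : ℝ} [Fact (0 < c₀)] (τ : 𝔸 →ₗ[ℂ] ℂ)
  {L η : ℝ} [Fact (0 < L)] [Fact (0 < η)] {lev₀ : Bond d Pd → ℕ} {κ' : Type*} [Fintype κ'] (lev₁ : κ' → ℕ) (Dc : (Bond d Pd → 𝔸) →ₗ[ℂ] (κ' → 𝔸))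

/-- **AN `L²` OPERATOR READ AS A CURRENT-VALUED MAP ON THE SPACE (115)**: `Y ↦ |·|₍₋₃₎`-current of `T` applied to the underlying bond function of `Y`
(read on the Hilbert fibre along `φ`) — the TYPE of the letters `Δπ`, `J` of [Balaban1985Variational] (80) in the cell's W₇; continuity is automatic
on the finite lattice. [cite: Balaban1985Variational, (80) p.290, (115) p.294, (27) p.282] -/
def currentCLM (T : BondL2K ℂ d Pd c₀ W →ₗ[ℂ] BondL2K ℂ d Pd c₀ W) : Space115 L η lev₀ lev₁ Dc →L[ℂ] NegSize L η lev₀ 3 𝔸 :=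
  LinearMap.toContinuousLinearMap
    ((NegSup.linearEquiv ℂ (levWeight L η lev₀ 3) : NegSize L η lev₀ 3 𝔸 ≃ₗ[ℂ] (Bond d Pd → 𝔸)).symm.toLinearMap ∘ₗ
      readFun φ (fun _ : Bond d Pd => c₀) (fun _ : Bond d Pd => c₀) T ∘ₗ (flat115 : Space115 L η lev₀ lev₁ Dc →L[ℂ] (Bond d Pd → 𝔸)).toLinearMap)

omit [FiniteDimensional ℂ W] [Fact (0 < c₀)] in
/-- Unfolding: the current underlying `currentCLM T Y` at the bond `b` is `φ` of `T` applied to `φ⁻¹ ∘ Y`. [cite: Balaban1985Variational, (27) p.282] -/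
theorem equiv_currentCLM (T : BondL2K ℂ d Pd c₀ W →ₗ[ℂ] BondL2K ℂ d Pd c₀ W) (Y : Space115 L η lev₀ lev₁ Dc) (b : Bond d Pd) :
    NegSup.equiv (levWeight L η lev₀ 3) 𝔸 (currentCLM φ lev₁ Dc T Y) b =
      φ (WL2.equiv ℂ _ W (T ((funEquiv φ (fun _ : Bond d Pd => c₀)).symm (flat115 Y))) b) := rfl

omit [FiniteDimensional ℂ W] [Fact (0 < c₀)] in
/-- The pairing sum of a read current against a bond function IS the bilinear trace pairing on the `L²` side (weight `c₀` pulled out).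
[cite: Balaban1985Variational, (27) p.282; Balaban1985BackgroundPropagators, (3.11) p.392] -/
theorem sum_trace_currentCLM (T : BondL2K ℂ d Pd c₀ W →ₗ[ℂ] BondL2K ℂ d Pd c₀ W) (Y : Space115 L η lev₀ lev₁ Dc) (Z : Bond d Pd → 𝔸) :
    (c₀ : ℂ) * ∑ b, τ (NegSup.equiv (levWeight L η lev₀ 3) 𝔸 (currentCLM φ lev₁ Dc T Y) b * Z b) =
      tpair φ τ (T ((funEquiv φ (fun _ : Bond d Pd => c₀)).symm (flat115 Y))) ((funEquiv φ (fun _ : Bond d Pd => c₀)).symm Z) := by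
  rw [tpair_def, Finset.mul_sum]
  refine Finset.sum_congr rfl fun b _ => ?_
  rw [equiv_currentCLM, funEquiv_symm_apply, LinearEquiv.apply_symm_apply]

omit [FiniteDimensional ℂ W] in
/-- **THE (27)-PAIRING FORM OF THE SYMMETRY** — the binder `hΔ` of the cell's W₇ (`B11Eq80Current.pair27_W80`, with `pair27_eq_sum`): for an `L²`
operator `T` symmetric for the bilinear trace pairing and a tracial `τ`, `η^d Σ_b τ((T̂Y)(b)·Z(b)) = η^d Σ_b τ((T̂Z)(b)·Y(b))`.
[cite: Balaban1985Variational, (27) p.282, (80) p.290; Balaban1985BackgroundPropagators, (3.119) p.419] -/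
theorem pairSum_currentCLM_comm (hτ₂ : ∀ X Y : 𝔸, τ (X * Y) = τ (Y * X)) {T : BondL2K ℂ d Pd c₀ W →ₗ[ℂ] BondL2K ℂ d Pd c₀ W}
    (hT : ∀ x y : BondL2K ℂ d Pd c₀ W, tpair φ τ x (T y) = tpair φ τ y (T x)) (Y Z : Space115 L η lev₀ lev₁ Dc) :
    ((η : ℂ)) ^ d * ∑ b, τ (NegSup.equiv (levWeight L η lev₀ 3) 𝔸 (currentCLM φ lev₁ Dc T Y) b * flat115 Z b) =
      ((η : ℂ)) ^ d * ∑ b, τ (NegSup.equiv (levWeight L η lev₀ 3) 𝔸 (currentCLM φ lev₁ Dc T Z) b * flat115 Y b) := by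
  have hc₀ : (c₀ : ℂ) ≠ 0 := by exact_mod_cast (Fact.out : 0 < c₀).ne'
  congr 1
  apply mul_left_cancel₀ hc₀
  rw [sum_trace_currentCLM, sum_trace_currentCLM, tpair_comm φ τ hτ₂, hT, tpair_comm φ τ hτ₂]

end Carrier

/-! ## §7 THE LETTER `Δπ` OF W₇ AT THE CHAIN'S CARRIER -/

section Letter

open B9SectCLatticeCarrier (Bond)
open B9Eq319QprimeTorus (fineP)
open B11Eq103H1Complex (SiteL2K BondL2K covDerivL2K covLaplaceSiteK funEquiv)
open B11Eq115Space (NegSup NegSize Space115 levWeight)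
open B11Eq90V0primeCurrent (flat115)
open B11Eq90Transpose (pair27 pair27_eq_sum)
open B9Eq310HessianOperator (adTransportW hessOp)
open B9Eq326OperatorAssembly (QprimeW)

variable {d : ℕ} (L : ℕ) [NeZero L] (m : Fin d → ℕ) {𝔸 : Type*} [NormedRing 𝔸] [NormedAlgebra ℂ 𝔸] [StarRing 𝔸] [StarModule ℂ 𝔸]
  [FiniteDimensional ℂ 𝔸] {W : Type*} [NormedAddCommGroup W] [InnerProductSpace ℂ W] [FiniteDimensional ℂ W] (φ : W ≃ₗ[ℂ] 𝔸)
  {c₀ : ℝ} [Fact (0 < c₀)] (τ : 𝔸 →ₗ[ℂ] ℂ) {Lr η : ℝ} [Fact (0 < Lr)] [Fact (0 < η)] (U : Bond d (fineP L m) → 𝔸ˣ)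
  (Gp : SiteL2K ℂ d (fineP L m) c₀ W →ₗ[ℂ] SiteL2K ℂ d (fineP L m) c₀ W)
  {lev₀ : Bond d (fineP L m) → ℕ} {κ' : Type*} [Fintype κ'] (lev₁ : κ' → ℕ) (Dc : (Bond d (fineP L m) → 𝔸) →ₗ[ℂ] (κ' → 𝔸))

/-- **THE LETTER `Δπ : Space115 L η lev₀ lev₁ Dc →L[ℂ] NegSize L η lev₀ 3 𝔸` OF THE CELL's W₇ (`B11Eq80Current.W80`∕`V80`: [Balaban1985Variational]
(80), (87)–(89)) AT THE pub-balaban NE9 CHAIN'S CARRIER**: the gauge-invariant extension `Δ_π(U) = π_Uᵗ Δ^η(U) π_U` of [B9] (3.119) read as a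
current-valued map on the space (115) (`Dc` generic; the owner instantiates `Dc := nabla115 η U`). [cite: Balaban1985Variational, (80) p.290, (87)–(89) p.291; Balaban1985BackgroundPropagators, (3.119) p.419] -/
def deltaPiCLM : Space115 Lr η lev₀ lev₁ Dc →L[ℂ] NegSize Lr η lev₀ 3 𝔸 := currentCLM φ lev₁ Dc (deltaPiOfU L m φ τ η U Gp)

/-- **THE SYMMETRY BINDER `hΔ` OF W₇ FOR `Δπ := deltaPiCLM …`, in the `pair27_eq_sum` form** `η^d Σ_b τ((Δπ Y)(b)·Z(b)) = η^d Σ_b τ((Δπ Z)(b)·Y(b))`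
— at a unitary background (`U(b)* = U(b)⁻¹`), for a `*`-TRACIAL `τ` and the cell's norming `⟪φ⁻¹X, φ⁻¹Y⟫ = τ(X*Y)`, WHATEVER the Green's-function
letter `G′`. [cite: Balaban1985Variational, (80) p.290; Balaban1985BackgroundPropagators, (3.119) p.419, (3.10) p.392] -/
theorem deltaPiCLM_pairSum_comm (hτ₂ : ∀ X Y : 𝔸, τ (X * Y) = τ (Y * X)) (hφ : ∀ X Y : 𝔸, ⟪φ.symm X, φ.symm Y⟫_ℂ = τ (star X * Y))
    (hU : ∀ b, star (U b : 𝔸) = ((U b)⁻¹ : 𝔸ˣ)) (Y Z : Space115 Lr η lev₀ lev₁ Dc) :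
    ((η : ℂ)) ^ d * ∑ b, τ (NegSup.equiv (levWeight Lr η lev₀ 3) 𝔸 (deltaPiCLM L m φ τ U Gp lev₁ Dc Y) b * flat115 Z b) =
      ((η : ℂ)) ^ d * ∑ b, τ (NegSup.equiv (levWeight Lr η lev₀ 3) 𝔸 (deltaPiCLM L m φ τ U Gp lev₁ Dc Z) b * flat115 Y b) :=
  pairSum_currentCLM_comm φ τ lev₁ Dc hτ₂ (tpair_deltaPiOfU_comm L m φ τ η U Gp hτ₂ hφ hU) Y Z

/-- **W₇'s BINDER `hΔ` VERBATIM** (`B11Eq80Current.pair27_W80`: `∀ Y Z, pair27 τ (Δπ Y) (flat115 Z) = pair27 τ (Δπ Z) (flat115 Y)`, the trace a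
continuous linear `τ : 𝔸 →L[ℂ] ℂ` as there) for `Δπ := deltaPiCLM L m φ ↑τ U Gp lev₁ Dc` — unitary background, tracial `τ`, the cell's norming.
[cite: Balaban1985Variational, (27) p.282, (80) p.290; Balaban1985BackgroundPropagators, (3.119) p.419] -/
theorem deltaPiCLM_pair27_comm (τ' : 𝔸 →L[ℂ] ℂ) (hτ₂ : ∀ X Y : 𝔸, τ' (X * Y) = τ' (Y * X))
    (hφ : ∀ X Y : 𝔸, ⟪φ.symm X, φ.symm Y⟫_ℂ = τ' (star X * Y)) (hU : ∀ b, star (U b : 𝔸) = ((U b)⁻¹ : 𝔸ˣ))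
    (Y Z : Space115 Lr η lev₀ lev₁ Dc) :
    pair27 τ' (deltaPiCLM L m φ (τ' : 𝔸 →ₗ[ℂ] ℂ) U Gp lev₁ Dc Y) (flat115 Z) =
      pair27 τ' (deltaPiCLM L m φ (τ' : 𝔸 →ₗ[ℂ] ℂ) U Gp lev₁ Dc Z) (flat115 Y) := by
  rw [pair27_eq_sum, pair27_eq_sum]
  exact deltaPiCLM_pairSum_comm L m φ (τ' : 𝔸 →ₗ[ℂ] ℂ) U Gp lev₁ Dc hτ₂ hφ hU Y Z

/-- **`Δπ` KILLS THE GAUGE MODES at the carrier**: for `λ ∈ N(Q′(U))` the (115)-configuration whose underlying bond function is `D_U λ` (read in `𝔸`)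
is sent to the zero current — given (g5) for the letter `G′`. [cite: Balaban1985BackgroundPropagators, (3.119) p.419; Balaban1985Variational, (88)–(89) p.291] -/
theorem deltaPiCLM_gaugeMode (hGp : ∀ l : SiteL2K ℂ d (fineP L m) c₀ W, QprimeW L m φ U l = 0 →
      Gp (covLaplaceSiteK ((η : ℂ))⁻¹ (adTransportW φ U) (adTransportW φ fun b => (U b)⁻¹) l) = l)
    {l : SiteL2K ℂ d (fineP L m) c₀ W} (hl : QprimeW L m φ U l = 0) (Y : Space115 Lr η lev₀ lev₁ Dc)
    (hY : flat115 Y = funEquiv φ (fun _ : Bond d (fineP L m) => c₀) (covDerivL2K ℂ c₀ ((η : ℂ))⁻¹ (adTransportW φ U) l)) :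
    deltaPiCLM L m φ τ U Gp lev₁ Dc Y = 0 := by
  apply (NegSup.equiv (levWeight Lr η lev₀ 3) 𝔸).injective
  funext b
  rw [deltaPiCLM, equiv_currentCLM, hY, LinearEquiv.symm_apply_apply, deltaPiOfU_gaugeMode L m φ τ η U Gp hGp hl, WL2.equiv_zero,
    Pi.zero_apply, map_zero]
  rfl

end Letter

end Literature.MathematicalPhysics.QuantumFieldTheory.Balaban1983to89.B9Eq3119DeltaPiCarrier

end
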